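import Mathlib.AlgebraicGeometry.Gluing
import Mathlib.AlgebraicGeometry.Morphisms.Basic
import Mathlib.AlgebraicGeometry.PullbackCarrier
import HarnessLib

/-!
# Zariski gluing from a cocycle, RELATIVE to a base, and morphisms of glue data with cartesian charts

[StacksProject, Tag 01JA] (glueing schemes) and [StacksProject, Tag 01LH] (relative glueing): given glue data
`(Uᵢ, Uᵢⱼ ⊆ Uᵢ, φᵢⱼ : Uᵢⱼ ⥲ Uⱼᵢ)` satisfying the cocycle condition there is a scheme `X = ⋃ Uᵢ` with `Uᵢ ∩ Uⱼ = Uᵢⱼ`;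
a family of morphisms `Uᵢ → S` agreeing on the `Uᵢⱼ` glues to `X → S` ([GortzWedhorn2020] Prop. 3.5, gluing of
morphisms); and if `(Zᵢ → Uᵢ)` is a family of `Uᵢ`-schemes with glue data COVERING that of the `Uᵢ` (the
overlaps `Zᵢⱼ` are the preimages of the `Uᵢⱼ`, the transition isomorphisms commute), the glued morphism
`Z → X` has `Z ×_X Uᵢ = Zᵢ` ([StacksProject, Tag 01LH]: «`f : X → S` such that `f⁻¹(Uᵢ) ≅ Xᵢ`»).

Mathlib supplies the absolute engine in COCYCLE form — `AlgebraicGeometry.Scheme.GlueData` (`glued`, the open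
immersions `ι i : U i ⟶ glued`, `vPullbackConeIsLimit` = «`Uᵢ ∩ Uⱼ = Vᵢⱼ`», `ι_eq_iff`, `openCover`) and the
multicoequalizer universal property — and the relative statement `Scheme.Cover.RelativeGluingData` only over a
LOCALLY DIRECTED thin index category (the canonical cover `D.openCover` of a cocycle gluing is not of that shape).
THIS FILE records, for glue data in cocycle form and with Mathlib-only imports:

* §0 two range computations: `Set.range fst = f ⁻¹' Set.range g` for ANY cartesian square of schemes
  (private `range_fst_of_isPullback`, = ★ `Resolution.range_eq_preimage_range_of_isPullback`, kept private so that
  the file stays Mathlib-only), and `(ι j)⁻¹(ι i (Uᵢ)) = f j i (Vⱼᵢ)` (`glueData_preimage_range_ι`);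
* §1 THE GLUED SCHEME OVER A BASE: morphisms `p i : U i ⟶ S` with `f i j ≫ p i = t i j ≫ f j i ≫ p j` glue
  uniquely to `q : glued ⟶ S` with `ι i ≫ q = p i` (`glueData_existsUnique_desc`, `glueData_hom_ext`), and `q`
  inherits every property local at the SOURCE from the `p i` (`glueData_desc_of_isZariskiLocalAtSource`);
* §2 MORPHISMS OF GLUE DATA: `φ i : D₁.U i ⟶ D₂.U (e i)` and `φV i j : D₁.V (i, j) ⟶ D₂.V (e i, e j)` commuting
  with the `f`'s and `t`'s glue uniquely to `Φ : D₁.glued ⟶ D₂.glued` with `D₁.ι i ≫ Φ = φ i ≫ D₂.ι (e i)`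
  (`glueData_existsUnique_map`, `glueData_map_unique`); if the `f`-squares are CARTESIAN (`D₁.V (i, j)` is the preimage of
  `D₂.V (e i, e j)`), then so are the charts: `D₁.U i = Φ⁻¹(D₂.U (e i))` (`glueData_isPullback_ι_map`);
* §3 consequences: `Φ` inherits every property local at the TARGET from the `φ i` when `e` is onto
  (`glueData_map_of_isZariskiLocalAtTarget`; e.g. `IsIso`, `glueData_isIso_map`), and `Φ` is a morphism OVER `S`
  when the `φ i` are (`glueData_map_comp_desc`).

Theorems only (no definition, no named fact, no `sorry`, no instance).  Cell hodgecm-mathlib, F-DAG price sheet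
(`B-provers/B-p03/g16/F-DAG-PRICE.B-p03g16.md`) §5b second hand (h7) «Zariski gluing of `S`-objects from a
cocycle», FILE 1; consumer leaf F-8 (8c)/(8e) (the coarse-free moduli scheme `A⁰ := ⋃ V_R` glued from slices and
its universal family glued from the restricted families).  HC_CM is proved only modulo the printed citations until
rung 0 closes; this file discharges none of them.

## References
* [StacksProject] The Stacks Project, Tag 01JA (Glueing schemes), Tag 01LH (Relative glueing).
* [GortzWedhorn2020] U. Görtz, T. Wedhorn, *Algebraic Geometry I*, 2nd ed. (2020), Section (3.3) Prop. 3.5 (gluing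
  of morphisms), Section (3.5) Def. 3.9 / Prop. 3.10 (gluing datum, gluing of schemes, its universal property),
  Section (4.8) Lemma 4.28 (points of fibre products), Section (4.9) Def. 4.29 (properties local on the target).
-/

noncomputable section

universe u

open CategoryTheory CategoryTheory.Limits AlgebraicGeometry TopologicalSpace

namespace Literature.AlgebraicGeometry.Morphisms

/-! ### §0 Range computations -/

/-- In ANY cartesian square of schemes `fst ≫ f = snd ≫ g`, the range of `fst` is the preimage under `f` of the
range of `g` (Mathlib `Scheme.Pullback.range_fst` for the chosen pullback, transported along
`IsPullback.isoPullback`).  Private copy of ★ `Resolution.range_eq_preimage_range_of_isPullback` (same statement;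
not imported here to keep this file Mathlib-only — that module sits on the Kollár resolution chain).
[cite: GortzWedhorn2020, Section (4.8) Lemma 4.28 (1)] -/
private theorem range_fst_of_isPullback {P X Y Z : Scheme.{u}} {fst : P ⟶ X} {snd : P ⟶ Y} {f : X ⟶ Z}
    {g : Y ⟶ Z} (h : IsPullback fst snd f g) :
    Set.range fst = f ⁻¹' Set.range g := by
  haveI : HasPullback f g := h.hasPullback
  rw [← Scheme.Pullback.range_fst f g, ← h.isoPullback_hom_fst]
  ext x
  constructor
  · rintro ⟨y, rfl⟩
    exact ⟨h.isoPullback.hom y, (Scheme.Hom.comp_apply _ _ _).symm⟩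
  · rintro ⟨y, rfl⟩
    refine ⟨h.isoPullback.inv y, ?_⟩
    rw [Scheme.Hom.comp_apply, ← Scheme.Hom.comp_apply _ h.isoPullback.hom, Iso.inv_hom_id]
    rfl

/-- For glue data `D`, the part of the chart `U j` lying over the chart `U i` inside the glued scheme is EXACTLY
(the image of) `V j i`: `(ι j)⁻¹(ι i(U i)) = f j i (V j i)` — «`Uᵢ ∩ Uⱼ = Uᵢⱼ`» of [StacksProject, Tag 01JA] read
on the chart `U j` (Mathlib `Scheme.GlueData.ι_eq_iff`; [GortzWedhorn2020] Prop. 3.10: «`ψᵢ(Uᵢ) ∩ ψⱼ(Uⱼ) = ψᵢ(Uᵢⱼ) = ψⱼ(Uⱼᵢ)`»).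
[cite: GortzWedhorn2020, Section (3.5) Proposition 3.10] [cite: StacksProject, Tag 01JA] -/
theorem glueData_preimage_range_ι (D : Scheme.GlueData.{u}) (i j : D.J) :
    (D.ι j) ⁻¹' Set.range (D.ι i) = Set.range (D.f j i) := by
  ext x
  constructor
  · rintro ⟨y, hy⟩
    obtain ⟨v, -, hv⟩ := (D.ι_eq_iff i j y x).mp hy
    dsimp only at v hv
    exact ⟨D.t i j v, by rw [← Scheme.Hom.comp_apply]; exact hv⟩
  · rintro ⟨w, rfl⟩
    refine ⟨D.f i j (D.t j i w), ?_⟩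
    rw [← Scheme.Hom.comp_apply, ← Scheme.Hom.comp_apply, D.glue_condition, Scheme.Hom.comp_apply]

/-! ### §1 The glued scheme over a base -/

/-- **Gluing of morphisms to a base** ([GortzWedhorn2020] Prop. 3.5; [StacksProject, Tag 01JA]): for glue data `D`
and morphisms `p i : U i ⟶ S` which agree on the overlaps — `f i j ≫ p i = t i j ≫ f j i ≫ p j` on `V i j` — there is a
UNIQUE `q : D.glued ⟶ S` with `ι i ≫ q = p i` for all `i` (the multicoequalizer universal property of
`D.glued`; uniqueness = Mathlib `Scheme.Cover.hom_ext` on `D.openCover`).  This makes the glued scheme an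
`S`-scheme ([GortzWedhorn2020] after Prop. 3.10: «there exists a unique morphism `ξ : X → T` with `ξ ∘ ψᵢ = ξᵢ`»).
[cite: GortzWedhorn2020, Section (3.3) Proposition 3.5 and Section (3.5) Proposition 3.10] [cite: StacksProject, Tag 01JA] -/
theorem glueData_existsUnique_desc (D : Scheme.GlueData.{u}) {S : Scheme.{u}} (p : ∀ i, D.U i ⟶ S)
    (hp : ∀ i j, D.f i j ≫ p i = D.t i j ≫ D.f j i ≫ p j) :
    ∃! q : D.glued ⟶ S, ∀ i, D.ι i ≫ q = p i := by
  refine ⟨Multicoequalizer.desc D.diagram S p (fun a => ?_), fun i => ?_, fun q hq => ?_⟩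
  · obtain ⟨i, j⟩ := a
    show D.f i j ≫ p i = (D.t i j ≫ D.f j i) ≫ p j
    rw [Category.assoc, hp]
  · exact Multicoequalizer.π_desc _ _ _ _ _
  · apply Multicoequalizer.hom_ext
    intro i
    rw [Multicoequalizer.π_desc]
    exact hq i

/-- **Uniqueness of glued morphisms** ([GortzWedhorn2020] Prop. 3.5: morphisms out of `X = ⋃ Uᵢ` agreeing on every
chart are equal; Mathlib `Scheme.Cover.hom_ext` on `D.openCover`) — the separate uniqueness head F-8 (8e) uses for
the independence of the classifying map from the choice of slices.
[cite: GortzWedhorn2020, Section (3.3) Proposition 3.5] [cite: StacksProject, Tag 01JA] -/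
theorem glueData_hom_ext (D : Scheme.GlueData.{u}) {S : Scheme.{u}} (q₁ q₂ : D.glued ⟶ S)
    (h : ∀ i, D.ι i ≫ q₁ = D.ι i ≫ q₂) : q₁ = q₂ :=
  Scheme.Cover.hom_ext D.openCover q₁ q₂ h

/-- The glued morphism `q : D.glued ⟶ S` inherits every property `P` which is ZARISKI-LOCAL AT THE SOURCE from the
chart morphisms `p i = ι i ≫ q` (e.g. `LocallyOfFiniteType`, `Flat`, `Smooth`, `IsOpenMap`-type properties;
Mathlib `IsZariskiLocalAtSource.of_openCover` on the canonical cover `D.openCover`).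
[cite: GortzWedhorn2020, Section (3.5) Proposition 3.10] [cite: StacksProject, Tag 01JA] -/
theorem glueData_desc_of_isZariskiLocalAtSource (D : Scheme.GlueData.{u}) {S : Scheme.{u}}
    (P : MorphismProperty Scheme.{u}) [IsZariskiLocalAtSource P] (p : ∀ i, D.U i ⟶ S) (q : D.glued ⟶ S)
    (hq : ∀ i, D.ι i ≫ q = p i) (h : ∀ i, P (p i)) : P q :=
  IsZariskiLocalAtSource.of_openCover D.openCover fun i => by
    have hi : D.openCover.f i ≫ q = p i := hq i
    rw [hi]
    exact h i

/-! ### §2 Morphisms of glue data -/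

section Map

variable (D₁ D₂ : Scheme.GlueData.{u}) (e : D₁.J → D₂.J) (φ : ∀ i, D₁.U i ⟶ D₂.U (e i))
  (φV : ∀ i j, D₁.V (i, j) ⟶ D₂.V (e i, e j))

/-- **Gluing a morphism of glue data** ([StacksProject, Tag 01JA], functoriality of glueing; [GortzWedhorn2020]
Prop. 3.5): given glue data `D₁`, `D₂`, a map of index sets `e`, chart morphisms `φ i : D₁.U i ⟶ D₂.U (e i)` and
overlap morphisms `φV i j : D₁.V (i, j) ⟶ D₂.V (e i, e j)` commuting with the inclusions `f` (`hf`) and the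
transition maps `t` (`ht`), there is a UNIQUE `Φ : D₁.glued ⟶ D₂.glued` with `D₁.ι i ≫ Φ = φ i ≫ D₂.ι (e i)` for
every chart. [cite: StacksProject, Tag 01JA] [cite: GortzWedhorn2020, Section (3.3) Proposition 3.5] -/
theorem glueData_existsUnique_map (hf : ∀ i j, φV i j ≫ D₂.f (e i) (e j) = D₁.f i j ≫ φ i)
    (ht : ∀ i j, φV i j ≫ D₂.t (e i) (e j) = D₁.t i j ≫ φV j i) :
    ∃! Φ : D₁.glued ⟶ D₂.glued, ∀ i, D₁.ι i ≫ Φ = φ i ≫ D₂.ι (e i) := by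
  refine glueData_existsUnique_desc D₁ (fun i => φ i ≫ D₂.ι (e i)) (fun i j => ?_)
  calc D₁.f i j ≫ φ i ≫ D₂.ι (e i)
      = φV i j ≫ D₂.f (e i) (e j) ≫ D₂.ι (e i) := by rw [← Category.assoc, ← hf, Category.assoc]
    _ = φV i j ≫ D₂.t (e i) (e j) ≫ D₂.f (e j) (e i) ≫ D₂.ι (e j) := by rw [D₂.glue_condition]
    _ = D₁.t i j ≫ φV j i ≫ D₂.f (e j) (e i) ≫ D₂.ι (e j) := by rw [← Category.assoc, ht, Category.assoc]
    _ = D₁.t i j ≫ D₁.f j i ≫ φ j ≫ D₂.ι (e j) := by rw [← Category.assoc (φV j i), hf, Category.assoc]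

variable {D₁ D₂ e φ φV}

/-- **Uniqueness of the glued morphism of glue data**: two morphisms `D₁.glued ⟶ D₂.glued` with the same charts
`φ i` coincide ([GortzWedhorn2020] Prop. 3.5). [cite: GortzWedhorn2020, Section (3.3) Proposition 3.5]
[cite: StacksProject, Tag 01JA] -/
theorem glueData_map_unique (Φ₁ Φ₂ : D₁.glued ⟶ D₂.glued) (h₁ : ∀ i, D₁.ι i ≫ Φ₁ = φ i ≫ D₂.ι (e i))
    (h₂ : ∀ i, D₁.ι i ≫ Φ₂ = φ i ≫ D₂.ι (e i)) : Φ₁ = Φ₂ :=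
  glueData_hom_ext D₁ Φ₁ Φ₂ fun i => by rw [h₁, h₂]

/-- **The charts of a glued morphism are CARTESIAN** ([StacksProject, Tag 01LH]: «`f⁻¹(Uᵢ) ≅ Xᵢ`»): if every overlap square is cartesian — `D₁.V (i, j)`
is the full preimage of `D₂.V (e i, e j)` under `φ i` (`hcart`) — then for any `Φ` glued from the `φ i` (`hΦ`) and
every chart `i`, the square `D₁.U i ⟶ D₁.glued`, `φ i`, `Φ`, `D₂.U (e i) ⟶ D₂.glued` is a pull-back:
`D₁.U i = Φ⁻¹(D₂.U (e i))`.  Proof: both are open immersions, so it suffices (Mathlib `IsOpenImmersion.isPullback`)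
that `Φ⁻¹(range ι (e i)) = range ι i`; a point of `D₁.U j` mapping into `D₂.U (e i)` maps into
`D₂.U (e i) ∩ D₂.U (e j) = D₂.V (e j, e i)` (§0), hence lies in `D₁.V (j, i)` (`hcart`), hence in `D₁.U i`.
[cite: StacksProject, Tag 01LH] [cite: GortzWedhorn2020, Section (3.5) Proposition 3.10 and Section (4.8) Lemma 4.28] -/
theorem glueData_isPullback_ι_map
    (hcart : ∀ i j, IsPullback (D₁.f i j) (φV i j) (φ i) (D₂.f (e i) (e j)))
    (Φ : D₁.glued ⟶ D₂.glued) (hΦ : ∀ i, D₁.ι i ≫ Φ = φ i ≫ D₂.ι (e i)) (i : D₁.J) :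
    IsPullback (D₁.ι i) (φ i) Φ (D₂.ι (e i)) := by
  refine (IsOpenImmersion.isPullback (φ i) (D₁.ι i) (D₂.ι (e i)) Φ (hΦ i) ?_).flip
  apply TopologicalSpace.Opens.ext
  simp only [TopologicalSpace.Opens.map_coe, Scheme.Hom.coe_opensRange]
  ext x
  constructor
  · intro hx
    obtain ⟨j, y, rfl⟩ := D₁.ι_jointly_surjective x
    have hy : φ j y ∈ (D₂.ι (e j)) ⁻¹' Set.range (D₂.ι (e i)) := by
      show D₂.ι (e j) (φ j y) ∈ Set.range (D₂.ι (e i))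
      rw [← Scheme.Hom.comp_apply, ← hΦ j, Scheme.Hom.comp_apply]
      exact hx
    rw [glueData_preimage_range_ι D₂ (e i) (e j)] at hy
    have hy' : y ∈ φ j ⁻¹' Set.range (D₂.f (e j) (e i)) := hy
    rw [← range_fst_of_isPullback (hcart j i)] at hy'
    obtain ⟨v, rfl⟩ := hy'
    refine ⟨D₁.f i j (D₁.t j i v), ?_⟩
    show D₁.ι i (D₁.f i j (D₁.t j i v)) = D₁.ι j (D₁.f j i v)
    rw [← Scheme.Hom.comp_apply, ← Scheme.Hom.comp_apply, D₁.glue_condition, Scheme.Hom.comp_apply]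
  · rintro ⟨y, rfl⟩
    exact ⟨φ i y, by rw [← Scheme.Hom.comp_apply, ← hΦ i, Scheme.Hom.comp_apply]⟩

/-! ### §3 Consequences: target-local properties and the structure over a base -/

/-- **A glued morphism inherits every property `P` which is ZARISKI-LOCAL AT THE TARGET from its charts**
([GortzWedhorn2020] Def. 4.29 «local on the target»; [StacksProject, Tag 01LH]): if `e` is onto (so the
charts `D₂.U (e i)` cover `D₂.glued`), the overlap squares are cartesian and every `φ i` satisfies `P`, then `Φ`
satisfies `P` — by §2 the restriction of `Φ` over the chart `D₂.U (e i)` IS `φ i` (Mathlib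
`IsZariskiLocalAtTarget.of_openCover`).  Instances: `IsProper`, `IsSeparated`, `Smooth`, `Flat`, `Etale`,
`IsIso` (`glueData_isIso_map`), … [cite: GortzWedhorn2020, Section (4.9) Definition 4.29] [cite: StacksProject, Tag 01LH] -/
theorem glueData_map_of_isZariskiLocalAtTarget (P : MorphismProperty Scheme.{u}) [IsZariskiLocalAtTarget P]
    (he : Function.Surjective e)
    (hcart : ∀ i j, IsPullback (D₁.f i j) (φV i j) (φ i) (D₂.f (e i) (e j)))
    (Φ : D₁.glued ⟶ D₂.glued) (hΦ : ∀ i, D₁.ι i ≫ Φ = φ i ≫ D₂.ι (e i)) (h : ∀ i, P (φ i)) : P Φ := by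
  refine IsZariskiLocalAtTarget.of_openCover D₂.openCover fun j => ?_
  obtain ⟨i, rfl⟩ := he j
  have hc := glueData_isPullback_ι_map hcart Φ hΦ i
  have key : P (hc.isoPullback.inv ≫ φ i) := (P.cancel_left_of_respectsIso hc.isoPullback.inv (φ i)).mpr (h i)
  have hsnd : D₂.openCover.pullbackHom Φ (e i) = hc.isoPullback.inv ≫ φ i := by
    rw [hc.isoPullback_inv_snd]
    rfl
  rw [hsnd]
  exact key

/-- **A morphism glued from isomorphisms is an isomorphism** (special case `P = isomorphisms`, Zariski-local at the
target: Mathlib instance in `AlgebraicGeometry.Gluing`). [cite: GortzWedhorn2020, Section (3.5) Proposition 3.10]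
[cite: StacksProject, Tag 01JA] -/
theorem glueData_isIso_map (he : Function.Surjective e)
    (hcart : ∀ i j, IsPullback (D₁.f i j) (φV i j) (φ i) (D₂.f (e i) (e j)))
    (Φ : D₁.glued ⟶ D₂.glued) (hΦ : ∀ i, D₁.ι i ≫ Φ = φ i ≫ D₂.ι (e i)) (h : ∀ i, IsIso (φ i)) :
    IsIso Φ :=
  glueData_map_of_isZariskiLocalAtTarget (MorphismProperty.isomorphisms Scheme.{u}) he hcart Φ hΦ
    fun i => (MorphismProperty.isomorphisms.iff _).mpr (h i)

/-- **The glued morphism is a morphism OVER the base** ([StacksProject, Tag 01LH]): if `q₁ : D₁.glued ⟶ S` and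
`q₂ : D₂.glued ⟶ S` are glued from `p₁ i` and `p₂ j` (§1) and every chart morphism is over `S`
(`φ i ≫ p₂ (e i) = p₁ i`), then `Φ ≫ q₂ = q₁` (Mathlib `Scheme.Cover.hom_ext` on `D₁.openCover`).
[cite: StacksProject, Tag 01LH] [cite: GortzWedhorn2020, Section (3.3) Proposition 3.5] -/
theorem glueData_map_comp_desc {S : Scheme.{u}} (p₁ : ∀ i, D₁.U i ⟶ S) (q₁ : D₁.glued ⟶ S)
    (hq₁ : ∀ i, D₁.ι i ≫ q₁ = p₁ i) (p₂ : ∀ j, D₂.U j ⟶ S) (q₂ : D₂.glued ⟶ S)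
    (hq₂ : ∀ j, D₂.ι j ≫ q₂ = p₂ j) (Φ : D₁.glued ⟶ D₂.glued) (hΦ : ∀ i, D₁.ι i ≫ Φ = φ i ≫ D₂.ι (e i))
    (hφ : ∀ i, φ i ≫ p₂ (e i) = p₁ i) : Φ ≫ q₂ = q₁ :=
  Scheme.Cover.hom_ext D₁.openCover _ _ fun i => by
    show D₁.ι i ≫ Φ ≫ q₂ = D₁.ι i ≫ q₁
    rw [← Category.assoc, hΦ, Category.assoc, hq₂, hφ, hq₁]

/-- **Points of the glued source over a chart** (set-theoretic reading of §2): with cartesian overlap squares, a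
point of `D₁.glued` maps under `Φ` into the chart `D₂.U (e i)` iff it lies in the chart `D₁.U i`.
[cite: StacksProject, Tag 01LH] -/
theorem glueData_preimage_range_ι_map
    (hcart : ∀ i j, IsPullback (D₁.f i j) (φV i j) (φ i) (D₂.f (e i) (e j)))
    (Φ : D₁.glued ⟶ D₂.glued) (hΦ : ∀ i, D₁.ι i ≫ Φ = φ i ≫ D₂.ι (e i)) (i : D₁.J) :
    Φ ⁻¹' Set.range (D₂.ι (e i)) = Set.range (D₁.ι i) :=
  (range_fst_of_isPullback (glueData_isPullback_ι_map hcart Φ hΦ i)).symm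

end Map

end Literature.AlgebraicGeometry.Morphisms

end
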